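import Literature.Analysis.Matrix.EigenvalueCountFromCongruence
import Literature.Computation.Certificates.SemidefiniteRigorousBoundsEigenCount
import HarnessLib

/-!
# Small duality gap + a certified eigenvalue count on the dual block ⇒ the primal block is nearly singular on `k` directions

Topic `Literature/Computation/Certificates` (joins `SemidefiniteComplementarity.lean` — (2.8)/(2.9) of
Blekherman–Parrilo–Thomas 2012 Ch. 2 and their quantitative "approximate complementary slackness" forms —
and `EigenvalueCountFromCongruence.lean` — the Courant–Fischer counting certificate).  This file assembles
the three printed ingredients into the one inequality an exact checker reads off a near-optimal primal–dual
pair of a semidefinite programme: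

* weak duality / the gap identity `⟨C, X⟩ − bᵀy = ⟨Z, X⟩`, `Z` the dual slack
  [BlekhermanParriloThomas2012, Ch. 2 eq. (2.8)] — so a pair with duality gap `≤ δ` has `Tr(Z X) ≤ δ`;
* the eigen-expansion `Tr(Z X) = Σ_i ζ_i · u_iᵀ X u_i` over an orthonormal eigenbasis of `Z`
  (`Jansson2007.trace_mul_eq_sum_eigenvalues_mul_rayleigh`, [Jansson2007, §6]);
* **Ky Fan's minimum principle** [HornJohnson2013, Cor. 4.3.39, (4.3.40) min form]
  (`KyFan.sum_eigenvalues₀_tail_le_sum_rayleigh`): the sum of the `k` smallest eigenvalues of `X` is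
  `≤ Σ_t h_tᵀ X h_t` for every orthonormal `k`-frame;
* **Courant–Fischer, counting form** [HornJohnson2013, Thm 4.2.6]
  (`EigenvalueCount.le_card_eigenvalues_gt_of_posDef`): `VᵀZV − θ VᵀV ≻ 0` with `k` columns ⇒ `Z` has
  `≥ k` eigenvalues `> θ`.

**Theorem** (`sum_smallest_eigenvalues_le_of_congruence_posDef`).  Let `Z, X` be real positive
semidefinite, `0 < θ`, `V` a real `ι × k` matrix with `VᵀZV − θ VᵀV` positive definite, and
`Tr(Z X) ≤ δ`.  Then the sum of the `k` smallest eigenvalues of `X` is `≤ δ/θ`.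
(Proof: `δ ≥ Tr(ZX) = Σ_i ζ_i q_i ≥ θ Σ_{i : ζ_i > θ} q_i`, `q_i = u_iᵀXu_i ≥ 0`; the `u_i` with `ζ_i > θ`
are `≥ k` orthonormal vectors, and Ky Fan bounds the `k` smallest eigenvalues of `X` by any `k` of the
`q_i`.)  This is the mechanism of the eigenvalue bounds by which near-optimal pairs approximate the optimal
partition of an SDP (Mohammad-Nezhad–Terlaky, *Parametric analysis of semidefinite optimization*,
Optimization 69 (2020) = arXiv:1808.00587, Lemma 2.3, with the unknown optimal partner replaced by a
certified near-optimal one): applied with `Z` = a certified dual slack block, `X` = ANY primal-feasible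
block of value within `δ` of the certified dual bound, it says that every (near-)optimal primal puts total
weight at most `δ/θ` on `k` directions — read off ONE certificate by an integer congruence test.
No named facts are introduced; everything stated is proved. `-- TODO(general form)`: complex Hermitian.

## References
* [HornJohnson2013] Horn–Johnson, *Matrix Analysis* 2nd ed., Thm 4.2.6, Cor. 4.3.39 (held p0305, p0318).
* [BlekhermanParriloThomas2012] Ch. 2 eq. (2.8), Lemma 2.12 (held p0023).
* [Jansson2007] C. Jansson, arXiv:0707.4366, §6 (held p0013).
-/

noncomputable section

open scoped Matrix

namespace Literature.Computation.Certificates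

namespace SubspaceComplementarity

open Finset _root_.Matrix Literature.Analysis.Matrix

variable {ι : Type*} [Fintype ι] [DecidableEq ι] {k : ℕ}

/-- **Eigen-expansion lower bound.** For real PSD `Z`, `X` and any real `θ`:
`θ · Σ_{i : θ < ζ_i} u_iᵀ X u_i ≤ Tr(Z X)`, where `ζ_i, u_i` are the eigenpairs of `Z`
(drop the terms with `ζ_i ≤ θ`, which are `≥ 0`, and use `ζ_i > θ` on the rest).
[cite: Jansson2007, §6 (proof of Cor. 6.1: `⟨D, X⟩` in eigen-coordinates)] -/
theorem smul_sum_rayleigh_le_trace_mul {Z X : Matrix ι ι ℝ} (hZ : Z.PosSemidef) (hX : X.PosSemidef)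
    (θ : ℝ) :
    θ * ∑ i ∈ univ.filter (fun i => θ < hZ.1.eigenvalues i),
        (hZ.1.eigenvectorBasis i).ofLp ⬝ᵥ (X *ᵥ (hZ.1.eigenvectorBasis i).ofLp) ≤ (Z * X).trace := by
  set q : ι → ℝ := fun i => (hZ.1.eigenvectorBasis i).ofLp ⬝ᵥ (X *ᵥ (hZ.1.eigenvectorBasis i).ofLp)
    with hq
  have hq0 : ∀ i, 0 ≤ q i := fun i => by
    have h := hX.dotProduct_mulVec_nonneg (hZ.1.eigenvectorBasis i).ofLp
    rwa [star_trivial] at h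
  rw [Jansson2007.trace_mul_eq_sum_eigenvalues_mul_rayleigh hZ.1 X, mul_sum]
  calc ∑ i ∈ univ.filter (fun i => θ < hZ.1.eigenvalues i), θ * q i
      ≤ ∑ i ∈ univ.filter (fun i => θ < hZ.1.eigenvalues i), hZ.1.eigenvalues i * q i := by
        refine sum_le_sum fun i hi => ?_
        exact mul_le_mul_of_nonneg_right (le_of_lt (mem_filter.mp hi).2) (hq0 i)
    _ ≤ ∑ i, hZ.1.eigenvalues i * q i := by
        refine sum_le_sum_of_subset_of_nonneg (filter_subset _ _) fun i _ _ => ?_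
        exact mul_nonneg (hZ.eigenvalues_nonneg i) (hq0 i)

/-- **Small gap + certified count ⇒ `k` nearly-null directions in every near-optimal primal.**  For real
positive semidefinite `Z`, `X`, `0 < θ`, and a real `ι × k` matrix `V` with `VᵀZV − θ VᵀV` positive
definite (an exact congruence certificate that `Z` has `≥ k` eigenvalues `> θ`): if `Tr(Z X) ≤ δ` then the
sum of the `k` SMALLEST eigenvalues of `X` is at most `δ/θ` (in Mathlib's decreasing `eigenvalues₀`, the
indices `rev 0, …, rev (k−1)`).  With `Z` a dual slack and `X` primal feasible, `Tr(Z X)` is the duality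
gap (2.8), so this bounds the `k` smallest eigenvalues of EVERY primal point whose value is within `δ` of
the dual bound. [cite: HornJohnson2013, Thm 4.2.6 and Cor. 4.3.39 (4.3.40); BlekhermanParriloThomas2012, Ch. 2 eq. (2.8)] -/
theorem sum_smallest_eigenvalues_le_of_congruence_posDef {Z X : Matrix ι ι ℝ} (hZ : Z.PosSemidef)
    (hX : X.PosSemidef) (V : Matrix ι (Fin k) ℝ) {θ δ : ℝ} (hθ : 0 < θ)
    (hV : (Vᵀ * Z * V - θ • (Vᵀ * V)).PosDef) (hgap : (Z * X).trace ≤ δ)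
    (hk : k ≤ Fintype.card ι) :
    ∑ t : Fin k, hX.1.eigenvalues₀ (Fin.rev (Fin.castLE hk t)) ≤ δ / θ := by
  -- the high index set of Z and an injection Fin k ↪ H
  let H := {i // θ < hZ.1.eigenvalues i}
  have hcount : k ≤ Fintype.card H := by
    rw [Fintype.card_subtype]
    exact EigenvalueCount.le_card_eigenvalues_gt_of_posDef hZ.1 V hV
  let g : Fin k → H := fun t => (Fintype.equivFin H).symm (Fin.castLE hcount t)
  have hg : Function.Injective g := fun s t hst => by
    have := (Fintype.equivFin H).symm.injective hst
    exact Fin.castLE_injective hcount this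
  -- the orthonormal k-frame of high eigenvectors of Z
  let u : ι → ι → ℝ := fun i => (hZ.1.eigenvectorBasis i).ofLp
  let h : Fin k → ι → ℝ := fun t => u (g t).1
  have horth : ∀ s t, h s ⬝ᵥ h t = if s = t then (1 : ℝ) else 0 := by
    intro s t
    show u (g s).1 ⬝ᵥ u (g t).1 = _
    rw [KyFan.eigenvectorBasis_dotProduct hZ.1]
    by_cases hst : s = t
    · subst hst; simp
    · have hne : (g s).1 ≠ (g t).1 := fun heq => hst (hg (Subtype.ext heq))
      rw [if_neg hne, if_neg hst]
  -- Ky Fan: the k smallest eigenvalues of X are below the frame's Rayleigh sum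
  have hKF := KyFan.sum_eigenvalues₀_tail_le_sum_rayleigh hX.1 hk h horth
  -- the frame's Rayleigh sum is part of the sum over all high eigenvectors
  set q : ι → ℝ := fun i => u i ⬝ᵥ (X *ᵥ u i) with hq
  have hq0 : ∀ i, 0 ≤ q i := fun i => by
    have h0 := hX.dotProduct_mulVec_nonneg (u i)
    rwa [star_trivial] at h0
  have hframe : ∑ t, h t ⬝ᵥ X *ᵥ h t ≤ ∑ i ∈ univ.filter (fun i => θ < hZ.1.eigenvalues i), q i := by
    have h1 : ∑ t, h t ⬝ᵥ X *ᵥ h t = ∑ i ∈ univ.image (fun t => (g t).1), q i := by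
      rw [sum_image (fun s _ t _ hst => hg (Subtype.ext hst))]
    rw [h1]
    refine sum_le_sum_of_subset_of_nonneg (fun i hi => ?_) fun i _ _ => hq0 i
    obtain ⟨t, _, rfl⟩ := mem_image.mp hi
    exact mem_filter.mpr ⟨mem_univ _, (g t).2⟩
  -- combine with the eigen-expansion bound θ Σ_H q ≤ Tr(ZX) ≤ δ
  have hsum := smul_sum_rayleigh_le_trace_mul hZ hX θ
  rw [le_div_iff₀ hθ]
  calc (∑ t : Fin k, hX.1.eigenvalues₀ (Fin.rev (Fin.castLE hk t))) * θ
      ≤ (∑ i ∈ univ.filter (fun i => θ < hZ.1.eigenvalues i), q i) * θ :=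
        mul_le_mul_of_nonneg_right (hKF.trans hframe) hθ.le
    _ ≤ δ := by rw [mul_comm]; exact hsum.trans hgap

end SubspaceComplementarity

end Literature.Computation.Certificates

end
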